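import Mathlib
import HarnessLib
import Summits.HubbardSuperconductivity.HubbardSuperconductivity.Theorems.KLProgrammeKLRegimeSplitPredicatesV3

/-!
# K3 ENGINE (stmt-HubbardSuperconductivity-20437 `KLRegimeEngineV17F2`), row (c): the DRESSED-SPLIT ROWS of package ζ FROM ROWS ON THE
# PINNED-LEG PRODUCTS — definition-free ∃-form (cell gate-hubbard-kl, seat hubbard-kl-k3c2-p2 g28; technique «thermal-bar induction n ≤ nScales β + 1»)

WHY.  Package ζ (`EngineV8.rowC_hexOut_of_pkgζ`, …KLRegimeEngineV17F2ClosersVGQOutE l.104–225) asks the producer to EXHIBIT a dressed split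
`Π = c₀ + F₁ + Σ_w F₂ʷ` of the two pinned-leg vertex products `Π = Pd` (direct) / `Px` (exchange) together with static pins `F₁₀ / Fx₁₀`
and to verify twenty rows about the pieces (the (S)/(P)/(W)/(ε) block: split identities, pin sups and Lipschitz rows — global and on angular
cells —, low-frequency flatness, window sups and supports).  The split is BOOKKEEPING.  This file proves, for ARBITRARY `Pd`, `Px`, ONE ∃-statement
`klds_exists_split_rows`: from rows stated on `Pd` / `Px` THEMSELVES — line sups and line Lipschitz data of the static restrictions `Pd|_{(ω₀,ω₀)}`,
`Px|_{(ω₀,ω₀ʳ)}`, the OFF-window and the ON-window low-frequency moduli — there EXIST `F₁ F₂ F₁₀ Fx₁ Fx₂ Fx₁₀` satisfying the twenty ζ-rows verbatim at `c₀ := 0`.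
Witnesses (inside the proof only, no definitions): `c₀ := 0`; `F₂ʷ` := the same-index low-frequency (`ω_i² ≤ (4Λ)²`) variation of `Pd` w.r.t. the
reference frequency on the FIRST window containing the running momentum; `F₁ := Pd − Σ_w F₂ʷ`; `F₁₀ := Pd|_{(ω₀,ω₀)}`; exchange twins with the adjacent
frequency pair (`Int i′ + 1 = Int i`, threshold `(5Λ)²`, reference `(ω₀, ω₀ʳ)`).  ROWC-AT-KILL.md §4(ii) (evidence #43 on 20437) is the sizing note.
* §1 `klds_sum_ite_first` (indicator sum over the first index); §2 **`klds_exists_split_rows`**.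
Plumbing only (model-free); nothing here asserts any row of package ζ, (c), K3 or superconductivity.  0 kit · 0 lit.
-/

noncomputable section

namespace Summit.HubbardSuperconductivity.HubbardSuperconductivity.Theorems.KLRegimeSplit

set_option linter.dupNamespace false -- summit = problem name (single-conjunct summit), D-0017

open Real Finset Literature.MathematicalPhysics.QuantumLattice Literature.Probability.LatticeModels

/-! ## §1 Indicator sum over the first index -/

section First

variable {Nw : ℕ}

/-- **Indicator sum over the FIRST index**: `Σ_w 𝟙[P w ∧ ∀ w′ < w, ¬P w′]·c = 𝟙[∃ w, P w]·c`. -/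
theorem klds_sum_ite_first (P : Fin Nw → Prop) (c : ℂ) [∀ w, Decidable (P w ∧ ∀ w' : Fin Nw, w' < w → ¬ P w')]
    [Decidable (∃ w, P w)] :
    (∑ w, if (P w ∧ ∀ w' : Fin Nw, w' < w → ¬ P w') then c else 0) = if (∃ w, P w) then c else 0 := by
  classical
  by_cases h : ∃ w, P w
  · rw [if_pos h]
    obtain ⟨w₀, hw₀, hmin⟩ := Finset.exists_min_image (Finset.univ.filter fun w => P w) (fun w : Fin Nw => (w : ℕ))
      (by obtain ⟨w, hw⟩ := h; exact ⟨w, by simp [hw]⟩)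
    have hP₀ : P w₀ := (Finset.mem_filter.mp hw₀).2
    have hfirst₀ : P w₀ ∧ ∀ w' : Fin Nw, w' < w₀ → ¬ P w' :=
      ⟨hP₀, fun w' hw' hPw' => absurd hw' (not_lt.mpr (Fin.le_def.mpr (hmin w' (by simp [hPw']))))⟩
    have huniq : ∀ w, (P w ∧ ∀ w' : Fin Nw, w' < w → ¬ P w') → w = w₀ := by
      intro w hw
      rcases lt_trichotomy w w₀ with hlt | heq | hgt
      · exact absurd hw.1 (hfirst₀.2 w hlt)
      · exact heq
      · exact absurd hP₀ (hw.2 w₀ hgt)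
    rw [Finset.sum_eq_single w₀ (fun w _ hw => if_neg fun hw' => hw (huniq w hw')) (fun h' => absurd (Finset.mem_univ _) h')]
    exact if_pos hfirst₀
  · rw [if_neg h]
    exact Finset.sum_eq_zero fun w _ => if_neg fun hw => h ⟨w, hw.1⟩

end First

/-! ## §2 The twenty (S)/(P)/(W)/(ε) rows of package ζ from rows on `Pd` / `Px` -/

section Split

variable {L M Nw Nc : ℕ}

/-- **`klds_exists_split_rows`** — package η ⇒ package ζ, split half (model-free).  Data: inverse temperature `β`, threshold `Λ` (= `klScale klE0 (n+1)`),
reference Matsubara indices `ω0` (= `omega0 M`), `ω0r` (= `(omega0 M).rev`), the pinned-leg products `Pd` (direct; arguments `t, p, σ, p′`) and `Px`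
(exchange; `t, p, p′`), line shifts `d` (= `x − y`) and `e` (= `Qm − x − y`), a parameter set `T` (= `Icc 0 1`), cells `S, Lc`, windows `cen, cenx, ρw, A₂`,
sizes `A₁, Kg, ε₁`.  Hypotheses = the rows ON `Pd`/`Px`: four line sups, four global line-Lipschitz rows, four cell line-Lipschitz rows, the two OFF-window
low-frequency moduli (`ε₁`), the two ON-window moduli (`A₂ w`).  Conclusion: `∃ F₁ F₂ F₁₀ Fx₁ Fx₂ Fx₁₀` with the twenty ζ-rows (at `c₀ := 0`) `hsplit hsplitX hY0p₁ hY1p₁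
hY0m₁ hY1m₁ hflat₁ hY0B₁ hY1B₁ hY0A₁ hY1A₁ hflatX₁ hcellp hcellm hcellB hcellA hF₂ hsupp₂ hFx₂ hsuppx₂` VERBATIM (in this order). -/
theorem klds_exists_split_rows (β Λ : ℝ) (ω0 ω0r : MatsubaraIdx M)
    (Pd : ℝ → FreqMomentum L M → Fin 2 → FreqMomentum L M → ℂ) (Px : ℝ → FreqMomentum L M → FreqMomentum L M → ℂ)
    (d e : TorusSite 2 L) (T : Set ℝ) (S : Fin Nc → Finset (TorusSite 2 L)) (Lc : Fin Nc → ℝ)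
    (cen cenx : Fin Nw → TorusSite 2 L) (ρw A₂ : Fin Nw → ℝ) {A₁ Kg ε₁ : ℝ}
    (hY0p : ∀ t ∈ T, ∀ k : TorusSite 2 L, ‖∑ σ : Fin 2, Pd t (ω0, k) σ (ω0, k + d)‖ ≤ A₁)
    (hY1p : ∀ t ∈ T, ∀ k k' : TorusSite 2 L,
      ‖(∑ σ : Fin 2, Pd t (ω0, k) σ (ω0, k + d)) - ∑ σ : Fin 2, Pd t (ω0, k') σ (ω0, k' + d)‖ ≤ Kg * klTorusNorm L (k - k'))
    (hY0m : ∀ t ∈ T, ∀ k : TorusSite 2 L, ‖∑ σ : Fin 2, Pd t (ω0, k + -d) σ (ω0, k)‖ ≤ A₁)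
    (hY1m : ∀ t ∈ T, ∀ k k' : TorusSite 2 L,
      ‖(∑ σ : Fin 2, Pd t (ω0, k + -d) σ (ω0, k)) - ∑ σ : Fin 2, Pd t (ω0, k' + -d) σ (ω0, k')‖ ≤ Kg * klTorusNorm L (k - k'))
    (hflat : ∀ t ∈ T, ∀ (i : MatsubaraIdx M) (σ : Fin 2) (k k' : TorusSite 2 L), matsubaraFreq β M i ^ 2 ≤ (4 * Λ) ^ 2 →
      (∀ w, ρw w < klTorusNorm L (k - cen w)) → ‖Pd t (i, k) σ (i, k') - Pd t (ω0, k) σ (ω0, k')‖ ≤ ε₁)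
    (hY0B : ∀ t ∈ T, ∀ k : TorusSite 2 L, ‖Px t (ω0, k) (ω0r, k + e)‖ ≤ A₁)
    (hY1B : ∀ t ∈ T, ∀ k k' : TorusSite 2 L, ‖Px t (ω0, k) (ω0r, k + e) - Px t (ω0, k') (ω0r, k' + e)‖ ≤ Kg * klTorusNorm L (k - k'))
    (hY0A : ∀ t ∈ T, ∀ k : TorusSite 2 L, ‖Px t (ω0, k + -e) (ω0r, k)‖ ≤ A₁)
    (hY1A : ∀ t ∈ T, ∀ k k' : TorusSite 2 L, ‖Px t (ω0, k + -e) (ω0r, k) - Px t (ω0, k' + -e) (ω0r, k')‖ ≤ Kg * klTorusNorm L (k - k'))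
    (hflatX : ∀ t ∈ T, ∀ (i i' : MatsubaraIdx M) (k k' : TorusSite 2 L), matsubaraInt M i' + 1 = matsubaraInt M i →
      matsubaraFreq β M i ^ 2 ≤ (5 * Λ) ^ 2 → (∀ w, ρw w < klTorusNorm L (k - cenx w)) →
        ‖Px t (i, k) (i', k') - Px t (ω0, k) (ω0r, k')‖ ≤ ε₁)
    (hcellp : ∀ t ∈ T, ∀ i, ∀ k ∈ S i, ∀ k' ∈ S i,
      ‖(∑ σ : Fin 2, Pd t (ω0, k) σ (ω0, k + d)) - ∑ σ : Fin 2, Pd t (ω0, k') σ (ω0, k' + d)‖ ≤ Lc i * klTorusNorm L (k - k'))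
    (hcellm : ∀ t ∈ T, ∀ i, ∀ k ∈ S i, ∀ k' ∈ S i,
      ‖(∑ σ : Fin 2, Pd t (ω0, k + -d) σ (ω0, k)) - ∑ σ : Fin 2, Pd t (ω0, k' + -d) σ (ω0, k')‖ ≤ Lc i * klTorusNorm L (k - k'))
    (hcellB : ∀ t ∈ T, ∀ i, ∀ k ∈ S i, ∀ k' ∈ S i, ‖Px t (ω0, k) (ω0r, k + e) - Px t (ω0, k') (ω0r, k' + e)‖ ≤ Lc i * klTorusNorm L (k - k'))
    (hcellA : ∀ t ∈ T, ∀ i, ∀ k ∈ S i, ∀ k' ∈ S i, ‖Px t (ω0, k + -e) (ω0r, k) - Px t (ω0, k' + -e) (ω0r, k')‖ ≤ Lc i * klTorusNorm L (k - k'))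
    (hε : 0 ≤ ε₁) (hA2 : ∀ w, 0 ≤ A₂ w)
    (hwin : ∀ t ∈ T, ∀ (w : Fin Nw) (i : MatsubaraIdx M) (σ : Fin 2) (k k' : TorusSite 2 L), matsubaraFreq β M i ^ 2 ≤ (4 * Λ) ^ 2 →
      klTorusNorm L (k - cen w) ≤ ρw w → ‖Pd t (i, k) σ (i, k') - Pd t (ω0, k) σ (ω0, k')‖ ≤ A₂ w)
    (hwinX : ∀ t ∈ T, ∀ (w : Fin Nw) (i i' : MatsubaraIdx M) (k k' : TorusSite 2 L), matsubaraInt M i' + 1 = matsubaraInt M i →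
      matsubaraFreq β M i ^ 2 ≤ (5 * Λ) ^ 2 → klTorusNorm L (k - cenx w) ≤ ρw w → ‖Px t (i, k) (i', k') - Px t (ω0, k) (ω0r, k')‖ ≤ A₂ w) :
    ∃ (F₁ : ℝ → FreqMomentum L M → Fin 2 → FreqMomentum L M → ℂ) (F₂ : Fin Nw → ℝ → FreqMomentum L M → Fin 2 → FreqMomentum L M → ℂ)
      (F₁₀ : ℝ → TorusSite 2 L → Fin 2 → TorusSite 2 L → ℂ) (Fx₁ : ℝ → FreqMomentum L M → FreqMomentum L M → ℂ)
      (Fx₂ : Fin Nw → ℝ → FreqMomentum L M → FreqMomentum L M → ℂ) (Fx₁₀ : ℝ → TorusSite 2 L → TorusSite 2 L → ℂ),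
      (∀ t ∈ T, ∀ (p : FreqMomentum L M) (σ : Fin 2) (p' : FreqMomentum L M), Pd t p σ p' = (0 : ℂ) + F₁ t p σ p' + ∑ w, F₂ w t p σ p') ∧
      (∀ t ∈ T, ∀ (p p' : FreqMomentum L M), Px t p p' = (0 : ℂ) + Fx₁ t p p' + ∑ w, Fx₂ w t p p') ∧
      (∀ t ∈ T, ∀ k : TorusSite 2 L, ‖∑ σ : Fin 2, F₁₀ t k σ (k + d)‖ ≤ A₁) ∧
      (∀ t ∈ T, ∀ k k' : TorusSite 2 L, ‖(∑ σ : Fin 2, F₁₀ t k σ (k + d)) - ∑ σ : Fin 2, F₁₀ t k' σ (k' + d)‖ ≤ Kg * klTorusNorm L (k - k')) ∧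
      (∀ t ∈ T, ∀ k : TorusSite 2 L, ‖∑ σ : Fin 2, F₁₀ t (k + -d) σ k‖ ≤ A₁) ∧
      (∀ t ∈ T, ∀ k k' : TorusSite 2 L, ‖(∑ σ : Fin 2, F₁₀ t (k + -d) σ k) - ∑ σ : Fin 2, F₁₀ t (k' + -d) σ k'‖ ≤ Kg * klTorusNorm L (k - k')) ∧
      (∀ t ∈ T, ∀ (i : MatsubaraIdx M) (σ : Fin 2) (k k' : TorusSite 2 L), matsubaraFreq β M i ^ 2 ≤ (4 * Λ) ^ 2 →
        ‖F₁ t (i, k) σ (i, k') - F₁₀ t k σ k'‖ ≤ ε₁) ∧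
      (∀ t ∈ T, ∀ k : TorusSite 2 L, ‖Fx₁₀ t k (k + e)‖ ≤ A₁) ∧
      (∀ t ∈ T, ∀ k k' : TorusSite 2 L, ‖Fx₁₀ t k (k + e) - Fx₁₀ t k' (k' + e)‖ ≤ Kg * klTorusNorm L (k - k')) ∧
      (∀ t ∈ T, ∀ k : TorusSite 2 L, ‖Fx₁₀ t (k + -e) k‖ ≤ A₁) ∧
      (∀ t ∈ T, ∀ k k' : TorusSite 2 L, ‖Fx₁₀ t (k + -e) k - Fx₁₀ t (k' + -e) k'‖ ≤ Kg * klTorusNorm L (k - k')) ∧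
      (∀ t ∈ T, ∀ (i i' : MatsubaraIdx M) (k k' : TorusSite 2 L), matsubaraInt M i' + 1 = matsubaraInt M i →
        matsubaraFreq β M i ^ 2 ≤ (5 * Λ) ^ 2 → ‖Fx₁ t (i, k) (i', k') - Fx₁₀ t k k'‖ ≤ ε₁) ∧
      (∀ t ∈ T, ∀ i, ∀ k ∈ S i, ∀ k' ∈ S i,
        ‖(∑ σ : Fin 2, F₁₀ t k σ (k + d)) - ∑ σ : Fin 2, F₁₀ t k' σ (k' + d)‖ ≤ Lc i * klTorusNorm L (k - k')) ∧
      (∀ t ∈ T, ∀ i, ∀ k ∈ S i, ∀ k' ∈ S i,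
        ‖(∑ σ : Fin 2, F₁₀ t (k + -d) σ k) - ∑ σ : Fin 2, F₁₀ t (k' + -d) σ k'‖ ≤ Lc i * klTorusNorm L (k - k')) ∧
      (∀ t ∈ T, ∀ i, ∀ k ∈ S i, ∀ k' ∈ S i, ‖Fx₁₀ t k (k + e) - Fx₁₀ t k' (k' + e)‖ ≤ Lc i * klTorusNorm L (k - k')) ∧
      (∀ t ∈ T, ∀ i, ∀ k ∈ S i, ∀ k' ∈ S i, ‖Fx₁₀ t (k + -e) k - Fx₁₀ t (k' + -e) k'‖ ≤ Lc i * klTorusNorm L (k - k')) ∧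
      (∀ t ∈ T, ∀ w (p : FreqMomentum L M) (σ : Fin 2) (p' : FreqMomentum L M), ‖F₂ w t p σ p'‖ ≤ A₂ w) ∧
      (∀ t ∈ T, ∀ w (p : FreqMomentum L M) (σ : Fin 2) (p' : FreqMomentum L M), ρw w < klTorusNorm L (p.2 - cen w) → F₂ w t p σ p' = 0) ∧
      (∀ t ∈ T, ∀ w (p p' : FreqMomentum L M), ‖Fx₂ w t p p'‖ ≤ A₂ w) ∧
      (∀ t ∈ T, ∀ w (p p' : FreqMomentum L M), ρw w < klTorusNorm L (p.2 - cenx w) → Fx₂ w t p p' = 0) := by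
  classical
  -- the window parts: same-index (direct) / adjacent-pair (exchange) low-frequency variation on the FIRST window containing `p.2`
  set F₂ : Fin Nw → ℝ → FreqMomentum L M → Fin 2 → FreqMomentum L M → ℂ := fun w t p σ p' =>
    if matsubaraFreq β M p.1 ^ 2 ≤ (4 * Λ) ^ 2 ∧ p'.1 = p.1 ∧
        (klTorusNorm L (p.2 - cen w) ≤ ρw w ∧ ∀ w' : Fin Nw, w' < w → ¬ klTorusNorm L (p.2 - cen w') ≤ ρw w') then
      Pd t p σ p' - Pd t (ω0, p.2) σ (ω0, p'.2) else 0 with hF₂def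
  set Fx₂ : Fin Nw → ℝ → FreqMomentum L M → FreqMomentum L M → ℂ := fun w t p p' =>
    if matsubaraFreq β M p.1 ^ 2 ≤ (5 * Λ) ^ 2 ∧ matsubaraInt M p'.1 + 1 = matsubaraInt M p.1 ∧
        (klTorusNorm L (p.2 - cenx w) ≤ ρw w ∧ ∀ w' : Fin Nw, w' < w → ¬ klTorusNorm L (p.2 - cenx w') ≤ ρw w') then
      Px t p p' - Px t (ω0, p.2) (ω0r, p'.2) else 0 with hFx₂def
  -- the window sums are the low-frequency variations on the UNION of the windows
  have hsum₂ : ∀ (t : ℝ) (p : FreqMomentum L M) (σ : Fin 2) (p' : FreqMomentum L M),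
      (∑ w, F₂ w t p σ p') = if (matsubaraFreq β M p.1 ^ 2 ≤ (4 * Λ) ^ 2 ∧ p'.1 = p.1 ∧ ∃ w, klTorusNorm L (p.2 - cen w) ≤ ρw w) then
        Pd t p σ p' - Pd t (ω0, p.2) σ (ω0, p'.2) else 0 := by
    intro t p σ p'
    by_cases hlow : matsubaraFreq β M p.1 ^ 2 ≤ (4 * Λ) ^ 2 ∧ p'.1 = p.1
    · have : (∑ w, F₂ w t p σ p') = ∑ w, if (klTorusNorm L (p.2 - cen w) ≤ ρw w ∧
            ∀ w' : Fin Nw, w' < w → ¬ klTorusNorm L (p.2 - cen w') ≤ ρw w') then Pd t p σ p' - Pd t (ω0, p.2) σ (ω0, p'.2) else 0 := by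
        refine Finset.sum_congr rfl fun w _ => ?_
        simp only [hF₂def]
        by_cases hw : klTorusNorm L (p.2 - cen w) ≤ ρw w ∧ ∀ w' : Fin Nw, w' < w → ¬ klTorusNorm L (p.2 - cen w') ≤ ρw w'
        · rw [if_pos ⟨hlow.1, hlow.2, hw⟩, if_pos hw]
        · rw [if_neg hw, if_neg fun h => hw h.2.2]
      rw [this, klds_sum_ite_first (fun w => klTorusNorm L (p.2 - cen w) ≤ ρw w)]
      by_cases hex : ∃ w, klTorusNorm L (p.2 - cen w) ≤ ρw w
      · rw [if_pos hex, if_pos ⟨hlow.1, hlow.2, hex⟩]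
      · rw [if_neg hex, if_neg fun h => hex h.2.2]
    · rw [if_neg fun h => hlow ⟨h.1, h.2.1⟩]
      refine Finset.sum_eq_zero fun w _ => ?_
      simp only [hF₂def]
      rw [if_neg fun h => hlow ⟨h.1, h.2.1⟩]
  have hsumx₂ : ∀ (t : ℝ) (p p' : FreqMomentum L M),
      (∑ w, Fx₂ w t p p') = if (matsubaraFreq β M p.1 ^ 2 ≤ (5 * Λ) ^ 2 ∧ matsubaraInt M p'.1 + 1 = matsubaraInt M p.1 ∧
          ∃ w, klTorusNorm L (p.2 - cenx w) ≤ ρw w) then Px t p p' - Px t (ω0, p.2) (ω0r, p'.2) else 0 := by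
    intro t p p'
    by_cases hlow : matsubaraFreq β M p.1 ^ 2 ≤ (5 * Λ) ^ 2 ∧ matsubaraInt M p'.1 + 1 = matsubaraInt M p.1
    · have : (∑ w, Fx₂ w t p p') = ∑ w, if (klTorusNorm L (p.2 - cenx w) ≤ ρw w ∧
            ∀ w' : Fin Nw, w' < w → ¬ klTorusNorm L (p.2 - cenx w') ≤ ρw w') then Px t p p' - Px t (ω0, p.2) (ω0r, p'.2) else 0 := by
        refine Finset.sum_congr rfl fun w _ => ?_
        simp only [hFx₂def]
        by_cases hw : klTorusNorm L (p.2 - cenx w) ≤ ρw w ∧ ∀ w' : Fin Nw, w' < w → ¬ klTorusNorm L (p.2 - cenx w') ≤ ρw w'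
        · rw [if_pos ⟨hlow.1, hlow.2, hw⟩, if_pos hw]
        · rw [if_neg hw, if_neg fun h => hw h.2.2]
      rw [this, klds_sum_ite_first (fun w => klTorusNorm L (p.2 - cenx w) ≤ ρw w)]
      by_cases hex : ∃ w, klTorusNorm L (p.2 - cenx w) ≤ ρw w
      · rw [if_pos hex, if_pos ⟨hlow.1, hlow.2, hex⟩]
      · rw [if_neg hex, if_neg fun h => hex h.2.2]
    · rw [if_neg fun h => hlow ⟨h.1, h.2.1⟩]
      refine Finset.sum_eq_zero fun w _ => ?_
      simp only [hFx₂def]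
      rw [if_neg fun h => hlow ⟨h.1, h.2.1⟩]
  refine ⟨fun t p σ p' => Pd t p σ p' - ∑ w, F₂ w t p σ p', F₂, fun t k σ k' => Pd t (ω0, k) σ (ω0, k'),
    fun t p p' => Px t p p' - ∑ w, Fx₂ w t p p', Fx₂, fun t k k' => Px t (ω0, k) (ω0r, k'),
    ?_, ?_, hY0p, hY1p, hY0m, hY1m, ?_, hY0B, hY1B, hY0A, hY1A, ?_, hcellp, hcellm, hcellB, hcellA, ?_, ?_, ?_, ?_⟩
  · -- (S) direct split identity
    intro t _ p σ p'; ring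
  · -- (S) exchange split identity
    intro t _ p p'; ring
  · -- (P) direct flatness from the OFF-window modulus
    intro t ht i σ k k' hi
    show ‖Pd t (i, k) σ (i, k') - (∑ w, F₂ w t (i, k) σ (i, k')) - Pd t (ω0, k) σ (ω0, k')‖ ≤ ε₁
    rw [hsum₂]
    by_cases hex : ∃ w, klTorusNorm L (k - cen w) ≤ ρw w
    · rw [if_pos ⟨hi, rfl, hex⟩]
      have : Pd t (i, k) σ (i, k') - (Pd t (i, k) σ (i, k') - Pd t (ω0, k) σ (ω0, k')) - Pd t (ω0, k) σ (ω0, k') = 0 := by ring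
      rw [this, norm_zero]; exact hε
    · rw [if_neg fun h => hex h.2.2, sub_zero]
      exact hflat t ht i σ k k' hi fun w => not_le.mp fun h => hex ⟨w, h⟩
  · -- (P) exchange flatness from the OFF-window adjacent-pair modulus
    intro t ht i i' k k' hadj hi
    show ‖Px t (i, k) (i', k') - (∑ w, Fx₂ w t (i, k) (i', k')) - Px t (ω0, k) (ω0r, k')‖ ≤ ε₁
    rw [hsumx₂]
    by_cases hex : ∃ w, klTorusNorm L (k - cenx w) ≤ ρw w
    · rw [if_pos ⟨hi, hadj, hex⟩]
      have : Px t (i, k) (i', k') - (Px t (i, k) (i', k') - Px t (ω0, k) (ω0r, k')) - Px t (ω0, k) (ω0r, k') = 0 := by ring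
      rw [this, norm_zero]; exact hε
    · rw [if_neg fun h => hex h.2.2, sub_zero]
      exact hflatX t ht i i' k k' hadj hi fun w => not_le.mp fun h => hex ⟨w, h⟩
  · -- (W) direct window sup from the ON-window modulus
    intro t ht w p σ p'
    simp only [hF₂def]
    split_ifs with h
    · obtain ⟨hlow, hsame, hfirst⟩ := h
      obtain ⟨i, k⟩ := p
      obtain ⟨i', k'⟩ := p'
      simp only at hsame hlow hfirst ⊢
      subst hsame
      exact hwin t ht w _ σ k k' hlow hfirst.1
    · simpa using hA2 w
  · -- (W) direct support row
    intro t _ w p σ p' hlt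
    simp only [hF₂def]
    rw [if_neg fun h' => absurd h'.2.2.1 (not_le.mpr hlt)]
  · -- (W) exchange window sup
    intro t ht w p p'
    simp only [hFx₂def]
    split_ifs with h
    · obtain ⟨hlow, hadj, hfirst⟩ := h
      obtain ⟨i, k⟩ := p
      obtain ⟨i', k'⟩ := p'
      exact hwinX t ht w i i' k k' hadj hlow hfirst.1
    · simpa using hA2 w
  · -- (W) exchange support row
    intro t _ w p p' hlt
    simp only [hFx₂def]
    rw [if_neg fun h' => absurd h'.2.2.1 (not_le.mpr hlt)]

end Split

end Summit.HubbardSuperconductivity.HubbardSuperconductivity.Theorems.KLRegimeSplit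

end
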